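import Summits.BirchSwinnertonDyer.Rank1Residual.O5.O5GrowthLaws
import HarnessLib

/-!
# O5 — T13: the Σ-depleted mod-3 congruence of the layer elements (additive `p = 3`, both branches, every layer)

Add-on to `O5GrowthLaws` (tree, p257909).  ONE conjecture node `DepletedCongruenceLawThree` (T13) + two defs.
T13 is the EXACT form of which T11 `CongruenceTransportLawThree` (λ-side) and the forced-`μ` half of T12 are
shadows: for mod-3-congruent same-type O5b curves `W ~ W′` the Σ-DEPLETED layer elements
`D^ε_n(W) = θ^ε_n(W) · ∏_{ℓ ∣ NN′, ℓ ≠ 3} P_ℓ(W; σ_ℓ⁻¹)` are CONGRUENT mod `3` up to one sign `u_ε ∈ {±1}` that does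
not depend on the layer — the Greenberg–Vatsal / Emerton–Pollack–Weston congruence of Σ-imprimitive `p`-adic
`L`-functions [cite: GreenbergVatsal2000, §2] [cite: EmertonPollackWeston2006, Thm. 1], read at an ADDITIVE
potentially supersingular prime where no `p`-adic `L`-function is available and the layer elements `θ_n` do not
form a norm-compatible system (`a₃ = 0`).  The inverse Frobenius `σ_ℓ⁻¹ ↦ (1+X)^{3^n − s(ℓ)}` is essential (with
`σ_ℓ⁺¹` the identity fails in ≈ 45 % of instances at `n ≥ 2`), which is what gives the census test teeth.
EVIDENCE-labelled conjecture (census cell O5, o5-r1 GEN 2, 2026-08-21): exploratory on the 2 284 congruent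
same-type O5b pairs of the C-A2c universe (`N ∈ (26 000, 500 000)`, cc-eng-3 ENG-D tower tables): 11 606
(pair, branch, layer) instances decided up to sign + 1 581 forced-zero instances (one side `≡ 0 mod 3` ⇒ the
other's depleted element `≡ 0`), 0 failures; sign constant in `n` for 2 269 / 2 269 pairs on each branch, the four
`(u₊, u₋)` combinations equidistributed (557 / 592 / 523 / 595); pre-registered independent-engine validation
C-A2f (PARI modular symbols, 50 pairs with `N ≤ 26 000`, disjoint from the discovery range; kit j128139; frozen scorer
`census/c_a2c/t13_validate.frozen_5c69a22eee4da1ee.py`): PASS — 325 decided (pair, branch, layer ≤ 5) instances, 0 kills,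
sign constant for 100/100 (pair, branch), `(u₊,u₋)` counts 24/26/26/24; post-hoc layer 0 (depleted `L`-VALUE congruence with the
same sign) 8/8.  See `HOME/b2b-bsdres-o5-r1/census/c_a2c/T13-PREREG.md` and the RESULT stamp in `HOME/cells/o5o6/TARGETS.md`.  Never a certificate input; no main
conjecture is used anywhere.

## TYPER PLACEMENT NOTE (cc-typer-5 GEN 4, typer of record O5 §3.5 / O6 §3.4, 2026-08-21)
Landed from o5-r1 GEN 2's file `HOME/b2b-bsdres-o5-r1/gen2/O5DepletedCongruence.lean` (sha16
261bf047b220c5b2) VERBATIM below this note (ASK A-O5-10). Vocabulary check: `eulerElementInvThree` is the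
tree's `eulerElementThree` (O5GrowthLaws, p257909) with the exponent `s ↦ (3^n − s) mod 3^n` (inverse
Frobenius) and nothing else changed; the `ℓ ∣ N` indicator is carried, as there, by `(a_ℓ² − a_{ℓ²})/ℓ²`
(`= 1/ℓ` at good `ℓ`, `= 0` at bad `ℓ`); `S = (N·N′).primeFactors.erase 3`; the congruence is typed as
`1 ≤ polyMuThree (D − C u · D′)` in `ℚ[X]` after `%ₘ ((X+1)^{3^n} − 1)`. DEDUP STANCE (one law, now THREE
formulations — recorded, not merged): T13 `DepletedCongruenceLawThree` is a strictly STRONGER statement than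
T11 `O5.CongruenceTransportLawThree` (λ-projection on O5b, same file family) and than (B)
`Additive.MazurTateLambdaCongruenceThree branch` (λ-projection off O5b); it implies T11 at every layer where
both depleted elements are nonzero mod 3 and the forced-μ half of T12 `O5.TamagawaDivisibilityLawThree`; the
bridge lemmas (T13 ⇒ T11, T13 ⇒ forced-μ) are prover items L-O56-λpoly / L-O56-euler of the DEDUP RULING
(p258252 docstring), not typed here. PRINTED-INPUT STATUS recorded by o5-r2 GEN 5 (F-O5-M2): the classical
route to such congruences (Vatsal 1999 → Greenberg–Vatsal 2000 → EPW 2006) uses mod-p multiplicity one /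
Gorenstein at the ρ̄-localised Hecke algebra, which FAILS at 9 ∥ N with U₃ ∈ m (μ(m) = 2; Agashe–Ribet–Stein 2012
Prop 2.3 for 99a1) — so T13 is an EVIDENCE node whose printed antecedent's hypothesis is known-false on (t′),
not a corollary-in-waiting; said so here so that no chain cites GV/EPW for it. Audit marks expected:
`conjecture` 1, `def` 2; 0 named Literature facts; census items, never Literature facts; nothing booked; no
mark of `RESIDUAL-MAP.md` moves.
-/

open scoped Classical MatrixGroups ModularForm NumberField
open CongruenceSubgroup Polynomial WeierstrassCurve NumberField Literature.NumberTheory.EllipticCurves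
  Literature.NumberTheory.EllipticCurves.ModularForms
  Summit.BirchSwinnertonDyer.Rank1Residual.Additive

namespace Summit.BirchSwinnertonDyer.Rank1Residual.O5

/-! ## §3c T13 — Σ-depleted congruence mod 3 (the exact law behind T11 and the forced-`μ` part of T12) -/

/-- The layer-`n` Euler factor element at `ℓ ≠ 3` on branch `ε` in the INVERSE Frobenius:
`P^ε_{ℓ,n}(W; σ_ℓ⁻¹) = 1 − χ_ε(ℓ) a_ℓ ℓ⁻¹ (1+X)^{(3^n − s) mod 3^n} + 1_{ℓ ∤ N} ℓ⁻¹ (1+X)^{2(3^n − s) mod 3^n}`,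
`s = layerIndexThree n ℓ`, `1_{ℓ ∤ N}·ℓ = a_ℓ² − a_{ℓ²}` (twin of `eulerElementThree`, which uses `σ_ℓ⁺¹`; the two
have the same `λ`, so T11 is insensitive to the choice, T13 is not). [cite: GreenbergVatsal2000, §2] -/
noncomputable def eulerElementInvThree (W : WeierstrassCurve ℚ) [W.IsElliptic] (ε : Bool) (ℓ n : ℕ) : ℚ[X] :=
  let s := (3 ^ n - layerIndexThree n ℓ) % 3 ^ n
  let a : ℚ := (W.LFunction ℓ : ℚ)
  let χ : ℚ := if ε then 1 else (jacobiSym (-3) ℓ : ℚ)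
  1 - C (χ * a / ℓ) * (X + 1) ^ s
    + C (((W.LFunction ℓ : ℚ) ^ 2 - (W.LFunction (ℓ ^ 2) : ℚ)) / (ℓ : ℚ) ^ 2) * (X + 1) ^ (2 * s % 3 ^ n)

/-- The `S`-DEPLETED layer element `D^ε_{S,n}(W) = θ^ε_n(f) · ∏_{ℓ ∈ S} P^ε_{ℓ,n}(W; σ_ℓ⁻¹)`, computed in
`ℚ[Γ_n] = ℚ[X]/((1+X)^{3^n} − 1)` and represented in degree `< 3^n` (`%ₘ` by the monic `(X+1)^{3^n} − 1`).
[cite: GreenbergVatsal2000, §2] -/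
noncomputable def depletedElementThree (S : Finset ℕ) (W : WeierstrassCurve ℚ) [W.IsElliptic] {N : ℕ}
    (f : CuspForm (Gamma0 N) 2) (ε : Bool) (n : ℕ) : ℚ[X] :=
  (branchElementThree f ε n * ∏ ℓ ∈ S, eulerElementInvThree W ε ℓ n) %ₘ ((X + 1) ^ (3 ^ n) - 1)

/-- **T13 DEPLETED CONGRUENCE LAW (THEOREM-CANDIDATE; E1/E3; EVIDENCE-labelled).**  For O5b curves `W, W′`
at `3` of the same Kodaira type (`v₃(Δ_min)` equal), `ρ̄_{W,3}` irreducible and `a_ℓ(W) ≡ a_ℓ(W′) (mod 3)` at every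
prime `ℓ ∤ 3NN′`, put `S = {ℓ prime : ℓ ∣ NN′, ℓ ≠ 3}`.  Then on each branch `ε` there is ONE sign `u_ε ∈ {±1}`
with, for EVERY layer `n ≥ 1`,
`D^ε_{S,n}(W) ≡ u_ε · D^ε_{S,n}(W′) (mod 3)`, i.e. `μ₃(D^ε_{S,n}(W) − u_ε D^ε_{S,n}(W′)) ≥ 1`
(coefficientwise in the `(1+X)`-representation of degree `< 3^n`; `u_ε` is the residue of the period ratio).
Consequences: `λ`-additivity in `𝔽₃[X]/(X^{3^n})` gives T11 at every layer where both depleted elements are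
nonzero mod 3; and `θ^ε_n(W) ≡ 0 (mod 3)` forces `D^ε_{S,n}(W′) ≡ 0` (the transported-`μ` mechanism of T12).
NORMALISATION CAVEAT (as for T12): typed for the tree's `ratPlusSymbol`/`ratMinusSymbol` normalisation
(`Ω^±_f`); the census engines use Néron lattice periods of each curve, which differ from `Ω^±_f` by 3-adic units
on O5b (no 3-isogenies since `ρ̄` is irreducible; Manin constant prime to 3 in the tested range) — units are
absorbed by `u_ε`.  Why it might fail: a congruent pair whose canonical periods differ from the newform periods by
a NON-unit at 3 on one side only (the statement would then hold only after rescaling), or a genuinely new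
additive-prime correction term at `ℓ = 3` itself (none is visible in 13 187 instances).
[evidence: census cell O5 (o5-r1 GEN 2, 2026-08-21): 11 606 + 1 581 instances on 2 284 pairs, 0 failures; sign
constant 2 269/2 269; pre-registered independent-engine validation C-A2f = kit j128139: PASS 325/325 decided, 0 kills, signs constant 100/100]
PRINTED ANTECEDENTS (none covers this case): Vatsal's congruence formula for the algebraic parts of twisted
`L`-values of congruent forms after removing the Euler factors at `ℓ ∣ NN′` needs the Gorenstein property of the
`ρ̄`-localised Hecke algebra, known for `p ∤ N` or `p ‖ N` with `ρ̄` `p`-distinguished [cite: Vatsal1999, §1 (main congruence theorem; locator to be fixed on acquisition)];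
at an additive prime it is an ASSUMPTION in print (arXiv:1808.07726, Assumption 6.22 / Thm. 6.23).  T13 asserts the
congruence at the additive potentially supersingular prime `3` (class `t′`), layer by layer, for Néron/newform periods.
[cite: GreenbergVatsal2000, §2] [cite: EmertonPollackWeston2006, Thm. 1] [cite: Vatsal1999, §1]
[cite: MazurTate1987, §1] -/
@[conjecture] def DepletedCongruenceLawThree : Prop :=
  ∀ (W W' : WeierstrassCurve ℚ) [W.IsElliptic] [W.IsGloballyMinimal] [NeZero (W.conductorNorm ℤ)]
    [W'.IsElliptic] [W'.IsGloballyMinimal] [NeZero (W'.conductorNorm ℤ)]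
    (f : CuspForm (Gamma0 (W.conductorNorm ℤ)) 2) (f' : CuspForm (Gamma0 (W'.conductorNorm ℤ)) 2),
    IsNewformOf W f → IsNewformOf W' f' → ClassO5 W 3 → SubTprime W 3 → ClassO5 W' 3 → SubTprime W' 3 →
    W.HasIrreducibleModPGaloisRep 3 → padicValRat 3 W.Δ = padicValRat 3 W'.Δ →
    (∀ ℓ : ℕ, ℓ.Prime → ¬ (ℓ ∣ 3 * W.conductorNorm ℤ * W'.conductorNorm ℤ) →
      ((W.LFunction ℓ : ℤ) : ZMod 3) = ((W'.LFunction ℓ : ℤ) : ZMod 3)) →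
    ∀ ε : Bool, ∃ u : ℤ, (u = 1 ∨ u = -1) ∧ ∀ n : ℕ, 1 ≤ n →
      (1 : WithTop ℤ) ≤ polyMuThree
        (depletedElementThree ((W.conductorNorm ℤ * W'.conductorNorm ℤ).primeFactors.erase 3) W f ε n -
          C (u : ℚ) *
            depletedElementThree ((W.conductorNorm ℤ * W'.conductorNorm ℤ).primeFactors.erase 3) W' f' ε n)

end Summit.BirchSwinnertonDyer.Rank1Residual.O5
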